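import Literature.Computability.Complexity.PromiseBPPAmplification
import Literature.Computability.Complexity.PromiseZPPProofs

/-!
# Crux `CubicForrelation.SignedCubicForrelationInPrBPP` (stmt-QuantumAdvantage-13933)

Stub `stub_passThrough` of the line `polar-radical-seeds` (generic promise-`BPP` plumbing, the last
step of the composition `SignedCubicForrelationInPrBPP_of`).

**Pass-through composition for textbook promise-BPP** (`PromiseBPP'`, Goldreich 2006, Def. 1.2;
Arora–Barak 2009, Def. 7.3). Let `dec ∈ FP` be a SAFE PARTIAL DECIDER for a promise problem `Q` on a pair
of sets `(EY, EN)`: a three-valued verdict (`[1]` accept / `[0]` reject / anything else = pass) that is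
wrong with probability `≤ 1/10` on every promise instance of `Q` and correct with probability `≥ 9/10`
on `EY` (accept) and `EN` (reject). Let `R ∈ PromiseBPP'` be any promise problem deciding the rest:
`Q.yes ∖ EY ⊆ R.yes`, `Q.no ∖ EN ⊆ R.no`. Then `Q ∈ PromiseBPP'`.

Proof. Amplify `R` to two-sided error `≤ 1/10` on its promise
(`PromiseProblem.exists_amplifier_of_mem_PromiseBPP'` with the constant polynomial `r = 9`): a witness
`L'' ∈ P` with `p''` coins. Use `p + p''` coins: the first block of `p(|x|)` coins is fed to `dec`
(`truncSndFn`), the second block of `p''(|x|)` coins to the decider of `L''` (`dropSndFn`). The witness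
language is
`W = (truncSndFn p)⁻¹{dec = [1]} ⊔ ((truncSndFn p)⁻¹{dec = [0]}ᶜ ⊓ (dropSndFn p)⁻¹ L'') ∈ P`
(accept if `dec` accepts; otherwise, unless `dec` rejects, follow `L''`); the fibres `{z | dec z = w}` are
in `P` as preimages of the equality language `EqPair` under the fan-out `z ↦ ⟨dec z, w⟩ ∈ FP`. Four cases,
each a union bound plus the cylinder rules (a prefix/suffix event keeps its probability,
`uniformProb_take_add` / `cnt_take_drop`):
* `x ∈ Q.yes ∩ EY`: `Pr[accept] ≥ Pr[dec = [1]] ≥ 9/10`;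
* `x ∈ Q.yes ∖ EY ⊆ R.yes`: `Pr[reject] ≤ Pr[dec = [0]] + Pr[block 2 ∉ L''] ≤ 1/10 + 1/10`;
* `x ∈ Q.no ∩ EN`: `Pr[reject] ≥ Pr[dec = [0]] ≥ 9/10` (`dec = [0]` excludes both disjuncts of `W`);
* `x ∈ Q.no ∖ EN ⊆ R.no`: `Pr[accept] ≤ Pr[dec = [1]] + Pr[block 2 ∈ L''] ≤ 1/5`.

Tree material used: `PromiseProblem.exists_amplifier_of_mem_PromiseBPP'` (`PromiseBPPAmplification`),
`truncSndFn_boolPair` / `dropSndFn_boolPair` and their `FP` membership (`CoinTruncation`),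
`preimage_mem_P`, `union_mem_P`, `inter_mem_P`, `compl_mem_P_iff`, `EqPair_mem_P`, `fanoutFn_mem_FP`,
`const_mem_FP`, `uniformProb_take_add` (`CountingHierarchyProofs`), `cnt_take_drop`
(`ProbabilisticClassesProofs`), `uniformProb_union_le` (`UniformProbBlocks`), `uniformProb_compl`.
-/

noncomputable section

set_option linter.dupNamespace false -- D-0017: single-problem summit ⇒ `QuantumAdvantage.QuantumAdvantage` by design

namespace Summit.QuantumAdvantage.QuantumAdvantage.Theorems.SignedCubicForrelationInPrBPP

open Literature.Computability.Complexity

/-- Monotonicity of the counting probability under inclusion of events (Arora–Barak 2009, §A.2). -/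
private theorem passThrough_uniformProb_mono {m : ℕ} {E E' : Set (List Bool)} (h : E ⊆ E') :
    uniformProb m E ≤ uniformProb m E' := by
  classical
  rw [uniformProb_eq_cnt_div, uniformProb_eq_cnt_div]
  refine div_le_div_of_nonneg_right ?_ (by positivity)
  have hle : cnt m E ≤ cnt m E' := by
    unfold cnt
    refine Finset.card_le_card fun r hr => ?_
    simp only [Finset.mem_filter, Finset.mem_univ, true_and] at hr ⊢
    exact h hr
  exact_mod_cast hle

/-- **Suffix events** keep their probability: `Pr_{y ∈ {0,1}^{m+d}}[y.drop m ∈ F] = Pr_{y ∈ {0,1}^d}[F]`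
(product rule `cnt_take_drop` with the sure event on the prefix; Arora–Barak 2009, §7.4.1). -/
private theorem passThrough_uniformProb_drop (m d : ℕ) (F : Set (List Bool)) :
    uniformProb (m + d) {y | y.drop m ∈ F} = uniformProb d F := by
  have h := cnt_take_drop m d Set.univ F
  rw [cnt_univ] at h
  have e : {y : List Bool | y.take m ∈ (Set.univ : Set (List Bool)) ∧ y.drop m ∈ F} =
      {y | y.drop m ∈ F} := by
    ext y; simp
  rw [e] at h
  rw [uniformProb_eq_cnt_div, uniformProb_eq_cnt_div, h, pow_add]
  push_cast
  rw [mul_div_mul_left _ _ (by positivity)]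

/-- **Fibres of an `FP` map are in `P`**: `{z | dec z = w} ∈ P` for `dec ∈ FP`, as the preimage of
the equality language `EqPair ∈ P` under the fan-out `z ↦ ⟨dec z, w⟩ ∈ FP` (Arora–Barak 2009, §1.3,
Thm. 2.8). -/
private theorem passThrough_fiber_mem_P {dec : List Bool → List Bool} (hdec : dec ∈ FP)
    (w : List Bool) : ({z | dec z = w} : Language Bool) ∈ Classes.P := by
  have h : ((fanoutFn dec fun _ => w) ⁻¹' EqPair : Language Bool) ∈ Classes.P :=
    preimage_mem_P EqPair_mem_P (fanoutFn_mem_FP hdec (const_mem_FP w))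
  have hset : ((fanoutFn dec fun _ => w) ⁻¹' EqPair : Language Bool) = {z | dec z = w} :=
    Set.ext fun z => by
      change fanoutFn dec (fun _ => w) z ∈ EqPair ↔ dec z = w
      rw [fanoutFn_apply, boolPair_mem_EqPair]
  rw [hset] at h
  exact h

/-- **Pass-through composition for `PromiseBPP'`** (stub `stub_passThrough` of the line
`polar-radical-seeds`): a safe partial `FP` decider for `Q` on `(EY, EN)` — wrong with probability
`≤ 1/10` on the whole promise of `Q`, answering correctly with probability `≥ 9/10` on `EY` / `EN` —
together with any `PromiseBPP'` decider of a promise problem `R` with `Q.yes ∖ EY ⊆ R.yes` and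
`Q.no ∖ EN ⊆ R.no` puts `Q` in `PromiseBPP'`. Amplify `R` to error `1/10`
(`PromiseProblem.exists_amplifier_of_mem_PromiseBPP'`, `r = 9`), run `dec` on the first coin block and,
unless it answers, the amplified decider on the second; union bound `1/10 + 1/10 ≤ 1/3` in all four
cases (Goldreich 2006, Def. 1.2; Arora–Barak 2009, §7.4.1). -/
theorem stub_passThrough : ∀ (Q R : PromiseProblem) (EY EN : Set (List Bool)),
    (∃ dec ∈ FP, ∃ p : Polynomial ℕ,
      (∀ x ∈ Q.yes, uniformProb (p.eval x.length) {y | dec (boolPair x y) = [false]} ≤ 1 / 10) ∧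
      (∀ x ∈ Q.no, uniformProb (p.eval x.length) {y | dec (boolPair x y) = [true]} ≤ 1 / 10) ∧
      (∀ x ∈ EY, (9 / 10 : ℝ) ≤ uniformProb (p.eval x.length) {y | dec (boolPair x y) = [true]}) ∧
      (∀ x ∈ EN, (9 / 10 : ℝ) ≤ uniformProb (p.eval x.length) {y | dec (boolPair x y) = [false]})) →
    R ∈ PromiseBPP' →
    (∀ x ∈ Q.yes, x ∉ EY → x ∈ R.yes) → (∀ x ∈ Q.no, x ∉ EN → x ∈ R.no) → Q ∈ PromiseBPP' := by
  intro Q R EY EN hdec hR hQR hQRno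
  obtain ⟨dec, hdecFP, p, hQyes, hQno, hEY, hEN⟩ := hdec
  -- amplify `R` to two-sided error `≤ 1/10` on its promise
  obtain ⟨L'', hL''P, p'', hRyes, hRno, -⟩ :=
    PromiseProblem.exists_amplifier_of_mem_PromiseBPP' hR (Polynomial.C 9)
  have hten : ∀ x : List Bool,
      (1 : ℝ) / ((Polynomial.C 9 : Polynomial ℕ).eval x.length + 1) = 1 / 10 := fun x => by
    rw [Polynomial.eval_C]; norm_num
  -- the witness language: accept if `dec` accepts block 1; else, unless `dec` rejects, follow `L''` on block 2
  set DT : Language Bool := {z | dec z = [true]} with hDT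
  set DF : Language Bool := {z | dec z = [false]} with hDF
  set W : Language Bool :=
    truncSndFn p ⁻¹' DT ⊔ (truncSndFn p ⁻¹' DFᶜ ⊓ dropSndFn p ⁻¹' L'') with hW
  have hWP : W ∈ Classes.P :=
    union_mem_P (preimage_mem_P (passThrough_fiber_mem_P hdecFP [true]) (truncSndFn_mem_FP p))
      (inter_mem_P
        (preimage_mem_P (compl_mem_P_iff.2 (passThrough_fiber_mem_P hdecFP [false]))
          (truncSndFn_mem_FP p))
        (preimage_mem_P hL''P (dropSndFn_mem_FP p)))
  have hmemW : ∀ x y : List Bool, boolPair x y ∈ W ↔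
      dec (boolPair x (y.take (p.eval x.length))) = [true] ∨
        (¬ dec (boolPair x (y.take (p.eval x.length))) = [false] ∧
          boolPair x (y.drop (p.eval x.length)) ∈ L'') := fun x y => by
    change (dec (truncSndFn p (boolPair x y)) = [true] ∨
      (¬ dec (truncSndFn p (boolPair x y)) = [false] ∧ dropSndFn p (boolPair x y) ∈ L'')) ↔ _
    rw [truncSndFn_boolPair, dropSndFn_boolPair]
  refine ⟨W, hWP, p + p'', fun x hx => ?_, fun x hx => ?_⟩
  · -- YES instances
    have hmemx : ∀ y : List Bool, boolPair x y ∈ W ↔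
        dec (boolPair x (y.take (p.eval x.length))) = [true] ∨
          (¬ dec (boolPair x (y.take (p.eval x.length))) = [false] ∧
            boolPair x (y.drop (p.eval x.length)) ∈ L'') := hmemW x
    have hB := hQyes x hx
    have hA9 : x ∈ EY → (9 / 10 : ℝ) ≤
        uniformProb (p.eval x.length) {y | dec (boolPair x y) = [true]} := fun h => hEY x h
    have hG : x ∉ EY → uniformProb (p''.eval x.length) {y | boolPair x y ∉ L''} ≤ 1 / 10 :=
      fun h => (hRyes x (hQR x hx h)).trans_eq (hten x)
    clear hmemW hQyes hQno hEY hEN hRyes hRno hQRno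
    rw [Polynomial.eval_add]
    set m : ℕ := p.eval x.length with hm
    set m'' : ℕ := p''.eval x.length with hm''
    by_cases hxE : x ∈ EY
    · -- `dec` accepts block 1 with probability `≥ 9/10`
      have hsub : {y : List Bool | y.take m ∈ {y' : List Bool | dec (boolPair x y') = [true]}} ⊆
          {y | boolPair x y ∈ W} := fun y hy => (hmemx y).2 (Or.inl hy)
      have hle := passThrough_uniformProb_mono (m := m + m'') hsub
      rw [uniformProb_take_add] at hle
      linarith [hA9 hxE]
    · -- rejection needs `dec = [0]` on block 1 or block 2 outside `L''`
      have hsub : {y : List Bool | boolPair x y ∉ W} ⊆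
          {y | y.take m ∈ {y' : List Bool | dec (boolPair x y') = [false]}} ∪
            {y | y.drop m ∈ {y' : List Bool | boolPair x y' ∉ L''}} := by
        intro y hy
        refine (Set.mem_union _ _ _).2 ?_
        by_cases hb : dec (boolPair x (y.take m)) = [false]
        · exact Or.inl hb
        · exact Or.inr fun hg => hy ((hmemx y).2 (Or.inr ⟨hb, hg⟩))
      have hc : uniformProb (m + m'') {y | boolPair x y ∉ W} ≤ 1 / 10 + 1 / 10 := by
        refine (passThrough_uniformProb_mono hsub).trans ((uniformProb_union_le _ _ _).trans ?_)
        rw [uniformProb_take_add, passThrough_uniformProb_drop]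
        exact add_le_add hB (hG hxE)
      have hcompl := uniformProb_compl (m + m'') {y | boolPair x y ∈ W}
      change uniformProb (m + m'') {y | boolPair x y ∉ W} = _ at hcompl
      linarith
  · -- NO instances
    have hmemx : ∀ y : List Bool, boolPair x y ∈ W ↔
        dec (boolPair x (y.take (p.eval x.length))) = [true] ∨
          (¬ dec (boolPair x (y.take (p.eval x.length))) = [false] ∧
            boolPair x (y.drop (p.eval x.length)) ∈ L'') := hmemW x
    have hA := hQno x hx
    have hB9 : x ∈ EN → (9 / 10 : ℝ) ≤
        uniformProb (p.eval x.length) {y | dec (boolPair x y) = [false]} := fun h => hEN x h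
    have hG : x ∉ EN → uniformProb (p''.eval x.length) {y | boolPair x y ∈ L''} ≤ 1 / 10 :=
      fun h => (hRno x (hQRno x hx h)).trans_eq (hten x)
    clear hmemW hQyes hQno hEY hEN hRyes hRno hQR
    rw [Polynomial.eval_add]
    set m : ℕ := p.eval x.length with hm
    set m'' : ℕ := p''.eval x.length with hm''
    by_cases hxE : x ∈ EN
    · -- `dec` rejects block 1 with probability `≥ 9/10`, and then `W` rejects
      have hsub : {y : List Bool | y.take m ∈ {y' : List Bool | dec (boolPair x y') = [false]}} ⊆
          {y | boolPair x y ∉ W} := by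
        intro y hy hyW
        have hy' : dec (boolPair x (y.take m)) = [false] := hy
        rcases (hmemx y).1 hyW with hA' | ⟨hB', -⟩
        · exact absurd (hy'.symm.trans hA') (by decide)
        · exact hB' hy'
      have hle := passThrough_uniformProb_mono (m := m + m'') hsub
      rw [uniformProb_take_add] at hle
      linarith [hB9 hxE]
    · -- acceptance needs `dec = [1]` on block 1 or block 2 inside `L''`
      have hsub : {y : List Bool | boolPair x y ∈ W} ⊆
          {y | y.take m ∈ {y' : List Bool | dec (boolPair x y') = [true]}} ∪
            {y | y.drop m ∈ {y' : List Bool | boolPair x y' ∈ L''}} := by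
        intro y hy
        refine (Set.mem_union _ _ _).2 ?_
        rcases (hmemx y).1 hy with hA' | ⟨-, hG'⟩
        · exact Or.inl hA'
        · exact Or.inr hG'
      have hc : uniformProb (m + m'') {y | boolPair x y ∈ W} ≤ 1 / 10 + 1 / 10 := by
        refine (passThrough_uniformProb_mono hsub).trans ((uniformProb_union_le _ _ _).trans ?_)
        rw [uniformProb_take_add, passThrough_uniformProb_drop]
        exact add_le_add hA (hG hxE)
      have hcompl := uniformProb_compl (m + m'') {y | boolPair x y ∈ W}
      change uniformProb (m + m'') {y | boolPair x y ∉ W} = _ at hcompl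
      linarith

end Summit.QuantumAdvantage.QuantumAdvantage.Theorems.SignedCubicForrelationInPrBPP

end
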